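import Literature.RepresentationTheory.HeisenbergGroup.SchrodingerLerayJunction
import Literature.NumberTheory.Weil1964.LocalLerayCocycleParabolic
import HarnessLib

/-!
# The Leray-normalised section on the Siegel parabolic and at the Weyl element (Rao's defining properties of `r`)

Topic `RepresentationTheory/HeisenbergGroup`; namespace `Literature.RepresentationTheory.HeisenbergGroup`. KERNEL
mathematics only (theorems; no definition, no named fact, no `axiom`, no `sorry`). Sequel of
`SchrodingerLerayJunction.lean` (the Schrödinger–Leray section `r = schrodingerLeraySection` of `Sp(F^ι ⊕ F^ι)` on
`𝒮(F^ι)`, whose multiplier is the Leray cocycle `c_{ℓ_Y}^{ψ(½·)}`, [Rangarao1993, Thm 4.1 (5)]) and of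
`Weil1964/LocalLerayCocycleParabolic.lean` (`c_ℓ(p, g) = c_ℓ(g, p) = 1` for `p` in the stabiliser `P_ℓ` of `ℓ`,
[Rangarao1993, Thm 4.1 (1)–(2)]).

* §1 **any Leray-normalised section is multiplicative against the stabiliser of its Lagrangian**: for a model `ρ`
  of `Heisenberg β`, a normalised section of implementers `r` with `c_r = c_ℓ` (`ℓ` a Lagrangian of `alt β`) and
  `p ∈ Sp` with `pℓ = ℓ`: `r(p g) = r(p) r(g)`, `r(g p) = r(g) r(p)`, hence `r(p₁ g p₂) = r(p₁) r(g) r(p₂)` and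
  `r|_{P_ℓ}` is a homomorphism (`ImplementerSection.apply_parabolic_mul`, `apply_mul_parabolic`,
  `apply_parabolic_mul_parabolic`) — [Rangarao1993] Thm 3.5 (1) "`r(p₁ σ p₂) = r(p₁) r(σ) r(p₂)`", Thm 4.1 (1)–(2).
* §2 **the values of the Schrödinger–Leray section on the generators** of `Sp(F^ι ⊕ F^ι)` (standard duality
  `⟨x, y⟩`, `ℓ_Y = 0 ⊕ F^ι`, self-dual measure): `r(w) = 𝓕` (the Fourier transform `fourierOpPi`, NO eighth root of
  unity — all Weil indices live in the cocycle), `r(m(a)) = leviOpPi a` (the tree's normalised Levi operator),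
  `r(n(c)) = unipOpPi c` (multiplication by `ψ(½⟨x, c x⟩)`), `r(m(a) n(c)) = leviOpPi a ∘ unipOpPi c`,
  `r(p₁ w p₂) = r(p₁) 𝓕 r(p₂)` for `p₁, p₂ ∈ P_{ℓ_Y}`, and `r(w)² = r(m(-1))` — [Rangarao1993] Lemma 3.2 (3.7)–(3.9),
  Thm 3.5 (1)–(3), p. 351–356; [Weil1964] n° 13 (29), p. 160; [MoeglinVignerasWaldspurger1987] Chap. 2 II.6.
  Together with `schrodingerLeraySection_eq_of_bijective` (the big cell `P w P`) these are Rao's DEFINING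
  PROPERTIES of the standard section on `P ∪ P w P`; by `ImplementerSectionRigidity.eq_of_cocycle_eq` the
  Schrödinger–Leray section is the unique normalised section with multiplier `c_{ℓ_Y}^{ψ(½·)}`.

## References

* R. Ranga Rao, Pacific J. Math. 157 (1993) 335–371: Lemma 3.2, Thm 3.5, Thm 4.1 (1)–(2) [Rangarao1993].
* A. Weil, Acta Math. 111 (1964) 143–211: n° 13 (29), p. 160 [Weil1964].
* C. Mœglin, M.-F. Vignéras, J.-L. Waldspurger, LNM 1291 (1987), Chap. 2 II.6 [MoeglinVignerasWaldspurger1987].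
-/

set_option autoImplicit false

noncomputable section

namespace Literature.RepresentationTheory.HeisenbergGroup

open _root_.MeasureTheory
open Literature.GroupTheory
open Literature.NumberTheory.Automorphic
open Literature.NumberTheory.GaloisRepresentations.IsNonarchimedeanLocalField
open Literature.NumberTheory.Weil1964
open Literature.LinearAlgebra.QuadraticForm

/-! ## §1 A Leray-normalised section is multiplicative against the stabiliser of its Lagrangian -/

section General

variable {F : Type*} [Field F] [ValuativeRel F] [TopologicalSpace F] [IsNonarchimedeanLocalField F]
  [MeasurableSpace F] [BorelSpace F] (μ : Measure F) [μ.IsAddHaarMeasure] {ψ : AddChar F Circle}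
  [Invertible (2 : F)]
variable {V : Type*} [AddCommGroup V] [Module F V] [FiniteDimensional F V] {β : V →ₗ[F] V →ₗ[F] F}
variable {S : Type*} [AddCommGroup S] [Module ℂ S] [Nontrivial S] {ρ : Representation ℂ (Heisenberg β) S}

namespace ImplementerSection

/-- **`r(p g) = r(p) r(g)` for `p` in the stabiliser of `ℓ`**, for any normalised section `r` with multiplier the
Leray cocycle `c_ℓ` (`c_ℓ(p, g) = 1`). [cite: Rangarao1993, Thm 3.5 (1), Thm 4.1 (1)–(2), p. 355–358] -/
theorem apply_parabolic_mul (hψ : ψ.IsContinuousNontrivial) (hA : (alt β).IsAlt) (hN : (alt β).Nondegenerate)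
    {ℓ : Submodule F V} (hℓ : LinearMap.BilinForm.orthogonal (alt β) ℓ = ℓ)
    (hU : ImplementerUniqueUpToScalar ρ) (r : ImplementerSection ρ)
    (hr : r.cocycle hU = lerayCentralCocycle μ hψ hA hN hℓ) {p : symplecticGroup β}
    (hp : ℓ.map ((p : V ≃ₗ[F] V) : V →ₗ[F] V) = ℓ) (g : symplecticGroup β) : r (p * g) = r p * r g :=
  (r.cocycle_eq_one_iff hU p g).1 (by
    rw [hr]
    refine Units.ext ?_
    change lerayCocycle ψ μ (alt β) ℓ (p : V ≃ₗ[F] V) (g : V ≃ₗ[F] V) = 1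
    exact lerayCocycle_eq_one_of_map_eq_left μ hψ (alt β) (isotropic_of_orthogonal_eq_self hℓ) hp _)

/-- **`r(g p) = r(g) r(p)` for `p` in the stabiliser of `ℓ`** (`c_ℓ(g, p) = 1`).
[cite: Rangarao1993, Thm 3.5 (1), Thm 4.1 (1)–(2), p. 355–358] -/
theorem apply_mul_parabolic (hψ : ψ.IsContinuousNontrivial) (hA : (alt β).IsAlt) (hN : (alt β).Nondegenerate)
    {ℓ : Submodule F V} (hℓ : LinearMap.BilinForm.orthogonal (alt β) ℓ = ℓ)
    (hU : ImplementerUniqueUpToScalar ρ) (r : ImplementerSection ρ)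
    (hr : r.cocycle hU = lerayCentralCocycle μ hψ hA hN hℓ) (g : symplecticGroup β) {p : symplecticGroup β}
    (hp : ℓ.map ((p : V ≃ₗ[F] V) : V →ₗ[F] V) = ℓ) : r (g * p) = r g * r p :=
  (r.cocycle_eq_one_iff hU g p).1 (by
    rw [hr]
    refine Units.ext ?_
    change lerayCocycle ψ μ (alt β) ℓ (g : V ≃ₗ[F] V) (p : V ≃ₗ[F] V) = 1
    exact lerayCocycle_eq_one_of_map_eq_right μ hψ (alt β) (isotropic_of_orthogonal_eq_self hℓ) g.2 hp)

/-- **[Rangarao1993, Thm 3.5 (1)] `r(p₁ g p₂) = r(p₁) r(g) r(p₂)`** for `p₁, p₂` in the stabiliser of `ℓ`.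
[cite: Rangarao1993, Thm 3.5 (1), p. 355] -/
theorem apply_parabolic_mul_parabolic (hψ : ψ.IsContinuousNontrivial) (hA : (alt β).IsAlt)
    (hN : (alt β).Nondegenerate) {ℓ : Submodule F V} (hℓ : LinearMap.BilinForm.orthogonal (alt β) ℓ = ℓ)
    (hU : ImplementerUniqueUpToScalar ρ) (r : ImplementerSection ρ)
    (hr : r.cocycle hU = lerayCentralCocycle μ hψ hA hN hℓ) {p₁ p₂ : symplecticGroup β}
    (hp₁ : ℓ.map ((p₁ : V ≃ₗ[F] V) : V →ₗ[F] V) = ℓ) (hp₂ : ℓ.map ((p₂ : V ≃ₗ[F] V) : V →ₗ[F] V) = ℓ)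
    (g : symplecticGroup β) : r (p₁ * g * p₂) = r p₁ * r g * r p₂ := by
  rw [apply_mul_parabolic μ hψ hA hN hℓ hU r hr _ hp₂, apply_parabolic_mul μ hψ hA hN hℓ hU r hr hp₁]

/-- **`r` restricted to the stabiliser `P_ℓ` is a homomorphism** (the extension splits over `P_ℓ` by `r` itself).
[cite: Rangarao1993, Thm 4.1 (2), p. 358; MoeglinVignerasWaldspurger1987, Chap. 2 II.6] -/
theorem apply_mul_of_parabolic (hψ : ψ.IsContinuousNontrivial) (hA : (alt β).IsAlt) (hN : (alt β).Nondegenerate)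
    {ℓ : Submodule F V} (hℓ : LinearMap.BilinForm.orthogonal (alt β) ℓ = ℓ)
    (hU : ImplementerUniqueUpToScalar ρ) (r : ImplementerSection ρ)
    (hr : r.cocycle hU = lerayCentralCocycle μ hψ hA hN hℓ) {p₁ p₂ : symplecticGroup β}
    (hp₁ : ℓ.map ((p₁ : V ≃ₗ[F] V) : V →ₗ[F] V) = ℓ) : r (p₁ * p₂) = r p₁ * r p₂ :=
  apply_parabolic_mul μ hψ hA hN hℓ hU r hr hp₁ p₂

/-- the inverse on the stabiliser: `r(p⁻¹) = r(p)⁻¹` for `pℓ = ℓ`. [cite: Rangarao1993, Thm 4.1 (2), p. 358] -/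
theorem apply_inv_of_parabolic (hψ : ψ.IsContinuousNontrivial) (hA : (alt β).IsAlt) (hN : (alt β).Nondegenerate)
    {ℓ : Submodule F V} (hℓ : LinearMap.BilinForm.orthogonal (alt β) ℓ = ℓ)
    (hU : ImplementerUniqueUpToScalar ρ) (r : ImplementerSection ρ)
    (hr : r.cocycle hU = lerayCentralCocycle μ hψ hA hN hℓ) {p : symplecticGroup β}
    (hp : ℓ.map ((p : V ≃ₗ[F] V) : V →ₗ[F] V) = ℓ) : r p⁻¹ = (r p)⁻¹ := by
  have h := apply_parabolic_mul μ hψ hA hN hℓ hU r hr hp p⁻¹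
  rw [mul_inv_cancel, r.map_one] at h
  exact eq_inv_of_mul_eq_one_right h.symm

end ImplementerSection

end General

/-! ## §2 The Schrödinger–Leray section on `P_{ℓ_Y}` and at `w` -/

section Pi

variable {F : Type*} [Field F] [ValuativeRel F] [TopologicalSpace F] [IsNonarchimedeanLocalField F]
  {ι : Type*} [Fintype ι] [DecidableEq ι] [Invertible (2 : F)]
  {ψ : AddChar F Circle} (hl : IsLocallyConstant (⇑ψ : F → Circle))
  (hb : ∀ y : ι → F, Continuous fun u : ι → F => dotProductBilin F F u y)
  [MeasurableSpace F] [BorelSpace F] (μ : Measure F) [μ.IsAddHaarMeasure] {m : ℤ}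

local notation "𝕍" => ((ι → F) × (ι → F))
local notation "Spι" => (symplecticGroup (polar (dotProductBilin F F (m := ι))))
local notation "ℓY" => (Submodule.prod (⊥ : Submodule F (ι → F)) (⊤ : Submodule F (ι → F)))
local notation "𝔸" => (alt (polar (dotProductBilin F F (m := ι))))
local notation "𝐧" => unipotentSp (dotProductBilin F F (m := ι))
local notation "𝐦" a:max => leviSp (dotProductBilin F F (m := ι)) a (dualLeviPi a) (dotProductBilin_apply_dualLeviPi a)
local notation "𝐰" => weylSp (dotProductBilin F F (m := ι)) (LinearEquiv.refl F (ι → F)) (LinearEquiv.neg F)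
  dotProductBilin_refl_neg'


/-! ### §2.1 The canonical data of `w`, `m(a) w`, `w n(c)` (all in the big cell) -/

omit [ValuativeRel F] [TopologicalSpace F] [IsNonarchimedeanLocalField F] [DecidableEq ι] [Invertible (2 : F)]
  [MeasurableSpace F] [BorelSpace F] in
/-- the `B`-block of `w` is `1`. [cite: Weil1964, n° 7, Prop. 1, p. 152] -/
theorem blockB_weylSp_apply (y : ι → F) : blockB ((𝐰 : Spι) : 𝕍 ≃ₗ[F] 𝕍) y = y := by
  simp only [blockB_apply, coe_weylSp, weylσ_apply, LinearEquiv.refl_apply]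

omit [ValuativeRel F] [TopologicalSpace F] [IsNonarchimedeanLocalField F] [DecidableEq ι] [Invertible (2 : F)]
  [MeasurableSpace F] [BorelSpace F] in
/-- `w` lies in the big cell (`B = 1` is bijective). [cite: Weil1964, n° 7, p. 152] -/
theorem blockB_weylSp_bijective : Function.Bijective (blockB ((𝐰 : Spι) : 𝕍 ≃ₗ[F] 𝕍)) := by
  have : blockB ((𝐰 : Spι) : 𝕍 ≃ₗ[F] 𝕍) = LinearMap.id := LinearMap.ext (blockB_weylSp_apply (F := F) (ι := ι))
  rw [this]; exact Function.bijective_id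

omit [ValuativeRel F] [TopologicalSpace F] [IsNonarchimedeanLocalField F] [DecidableEq ι] [Invertible (2 : F)]
  [MeasurableSpace F] [BorelSpace F] in
/-- canonical data of `w`: `B = 1`. [cite: Weil1964, n° 7, Prop. 1, p. 152] -/
theorem cellB_weylSp (hB : Function.Bijective (blockB ((𝐰 : Spι) : 𝕍 ≃ₗ[F] 𝕍))) :
    cellB ((𝐰 : Spι) : 𝕍 ≃ₗ[F] 𝕍) hB = 1 :=
  LinearEquiv.ext fun y => by rw [cellB_apply, blockB_weylSp_apply]; rfl

omit [ValuativeRel F] [TopologicalSpace F] [IsNonarchimedeanLocalField F] [DecidableEq ι] [Invertible (2 : F)]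
  [MeasurableSpace F] [BorelSpace F] in
/-- canonical data of `w`: `γ = 0`. [cite: Weil1964, n° 7, Prop. 1, p. 152] -/
theorem cellGamma_weylSp (hB : Function.Bijective (blockB ((𝐰 : Spι) : 𝕍 ≃ₗ[F] 𝕍))) :
    cellGamma ((𝐰 : Spι) : 𝕍 ≃ₗ[F] 𝕍) hB = 0 :=
  LinearMap.ext fun x => by
    simp only [cellGamma_apply, blockD_apply, coe_weylSp, weylσ_apply, LinearEquiv.neg_apply, neg_zero,
      LinearMap.zero_apply]

omit [ValuativeRel F] [TopologicalSpace F] [IsNonarchimedeanLocalField F] [DecidableEq ι] [Invertible (2 : F)]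
  [MeasurableSpace F] [BorelSpace F] in
/-- canonical data of `w`: `δ = 0`. [cite: Weil1964, n° 7, Prop. 1, p. 152] -/
theorem cellDelta_weylSp (hB : Function.Bijective (blockB ((𝐰 : Spι) : 𝕍 ≃ₗ[F] 𝕍))) :
    cellDelta ((𝐰 : Spι) : 𝕍 ≃ₗ[F] 𝕍) hB = 0 :=
  LinearMap.ext fun x => by
    simp only [cellDelta_apply, blockA_apply, coe_weylSp, weylσ_apply, map_zero, LinearMap.zero_apply]

omit [ValuativeRel F] [TopologicalSpace F] [IsNonarchimedeanLocalField F] [Invertible (2 : F)] [MeasurableSpace F]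
  [BorelSpace F] in
/-- the `B`-block of `m(a') w` is `a'`. [cite: Weil1964, n° 7, Prop. 1, p. 152] -/
theorem blockB_leviSp_mul_weylSp_apply (a' : (ι → F) ≃ₗ[F] (ι → F)) (y : ι → F) :
    blockB ((𝐦 a' * 𝐰 : Spι) : 𝕍 ≃ₗ[F] 𝕍) y = a' y := by
  simp only [blockB_apply, Subgroup.coe_mul, LinearEquiv.mul_apply, coe_weylSp, weylσ_apply, coe_leviSp_apply,
    LinearEquiv.refl_apply]

omit [ValuativeRel F] [TopologicalSpace F] [IsNonarchimedeanLocalField F] [Invertible (2 : F)] [MeasurableSpace F]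
  [BorelSpace F] in
/-- `m(a') w` lies in the big cell. [cite: Weil1964, n° 7, p. 152] -/
theorem blockB_leviSp_mul_weylSp_bijective (a' : (ι → F) ≃ₗ[F] (ι → F)) :
    Function.Bijective (blockB ((𝐦 a' * 𝐰 : Spι) : 𝕍 ≃ₗ[F] 𝕍)) := by
  have : blockB ((𝐦 a' * 𝐰 : Spι) : 𝕍 ≃ₗ[F] 𝕍) = (a' : (ι → F) →ₗ[F] (ι → F)) :=
    LinearMap.ext (blockB_leviSp_mul_weylSp_apply (F := F) (ι := ι) a')
  rw [this]; exact a'.bijective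

omit [ValuativeRel F] [TopologicalSpace F] [IsNonarchimedeanLocalField F] [Invertible (2 : F)] [MeasurableSpace F]
  [BorelSpace F] in
/-- canonical data of `m(a') w`: `B = a'`. [cite: Weil1964, n° 7, Prop. 1, p. 152] -/
theorem cellB_leviSp_mul_weylSp (a' : (ι → F) ≃ₗ[F] (ι → F))
    (hB : Function.Bijective (blockB ((𝐦 a' * 𝐰 : Spι) : 𝕍 ≃ₗ[F] 𝕍))) :
    cellB ((𝐦 a' * 𝐰 : Spι) : 𝕍 ≃ₗ[F] 𝕍) hB = a' :=
  LinearEquiv.ext fun y => by rw [cellB_apply, blockB_leviSp_mul_weylSp_apply]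

omit [ValuativeRel F] [TopologicalSpace F] [IsNonarchimedeanLocalField F] [Invertible (2 : F)] [MeasurableSpace F]
  [BorelSpace F] in
/-- canonical data of `m(a') w`: `γ = 0`. [cite: Weil1964, n° 7, Prop. 1, p. 152] -/
theorem cellGamma_leviSp_mul_weylSp (a' : (ι → F) ≃ₗ[F] (ι → F))
    (hB : Function.Bijective (blockB ((𝐦 a' * 𝐰 : Spι) : 𝕍 ≃ₗ[F] 𝕍))) :
    cellGamma ((𝐦 a' * 𝐰 : Spι) : 𝕍 ≃ₗ[F] 𝕍) hB = 0 :=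
  LinearMap.ext fun x => by
    simp only [cellGamma_apply, blockD_apply, Subgroup.coe_mul, LinearEquiv.mul_apply, coe_weylSp, weylσ_apply,
      coe_leviSp_apply, map_zero, LinearMap.zero_apply]

omit [ValuativeRel F] [TopologicalSpace F] [IsNonarchimedeanLocalField F] [Invertible (2 : F)] [MeasurableSpace F]
  [BorelSpace F] in
/-- canonical data of `m(a') w`: `δ = 0`. [cite: Weil1964, n° 7, Prop. 1, p. 152] -/
theorem cellDelta_leviSp_mul_weylSp (a' : (ι → F) ≃ₗ[F] (ι → F))
    (hB : Function.Bijective (blockB ((𝐦 a' * 𝐰 : Spι) : 𝕍 ≃ₗ[F] 𝕍))) :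
    cellDelta ((𝐦 a' * 𝐰 : Spι) : 𝕍 ≃ₗ[F] 𝕍) hB = 0 :=
  LinearMap.ext fun x => by
    simp only [cellDelta_apply, blockA_apply, Subgroup.coe_mul, LinearEquiv.mul_apply, coe_weylSp, weylσ_apply,
      coe_leviSp_apply, map_zero, LinearMap.zero_apply]

omit [ValuativeRel F] [TopologicalSpace F] [IsNonarchimedeanLocalField F] [DecidableEq ι] [MeasurableSpace F]
  [BorelSpace F] in
/-- the `B`-block of `w n(c)` is `1`. [cite: Weil1964, n° 7, Prop. 1, p. 152] -/
theorem blockB_weylSp_mul_unipotentSp_apply (c : (ι → F) →ₗ[F] (ι → F))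
    (hc : ∀ x x' : ι → F, dotProductBilin F F x (c x') = dotProductBilin F F x' (c x)) (y : ι → F) :
    blockB ((𝐰 * 𝐧 c hc : Spι) : 𝕍 ≃ₗ[F] 𝕍) y = y := by
  simp only [blockB_apply, Subgroup.coe_mul, LinearEquiv.mul_apply, coe_weylSp, weylσ_apply, coe_unipotentSp,
    unipotentσ_apply, map_zero, add_zero, LinearEquiv.refl_apply]

omit [ValuativeRel F] [TopologicalSpace F] [IsNonarchimedeanLocalField F] [DecidableEq ι] [MeasurableSpace F]
  [BorelSpace F] in
/-- `w n(c)` lies in the big cell. [cite: Weil1964, n° 7, p. 152] -/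
theorem blockB_weylSp_mul_unipotentSp_bijective (c : (ι → F) →ₗ[F] (ι → F))
    (hc : ∀ x x' : ι → F, dotProductBilin F F x (c x') = dotProductBilin F F x' (c x)) :
    Function.Bijective (blockB ((𝐰 * 𝐧 c hc : Spι) : 𝕍 ≃ₗ[F] 𝕍)) := by
  have : blockB ((𝐰 * 𝐧 c hc : Spι) : 𝕍 ≃ₗ[F] 𝕍) = LinearMap.id :=
    LinearMap.ext (blockB_weylSp_mul_unipotentSp_apply (F := F) (ι := ι) c hc)
  rw [this]; exact Function.bijective_id

omit [ValuativeRel F] [TopologicalSpace F] [IsNonarchimedeanLocalField F] [DecidableEq ι] [MeasurableSpace F]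
  [BorelSpace F] in
/-- canonical data of `w n(c)`: `B = 1`. [cite: Weil1964, n° 7, Prop. 1, p. 152] -/
theorem cellB_weylSp_mul_unipotentSp (c : (ι → F) →ₗ[F] (ι → F))
    (hc : ∀ x x' : ι → F, dotProductBilin F F x (c x') = dotProductBilin F F x' (c x))
    (hB : Function.Bijective (blockB ((𝐰 * 𝐧 c hc : Spι) : 𝕍 ≃ₗ[F] 𝕍))) :
    cellB ((𝐰 * 𝐧 c hc : Spι) : 𝕍 ≃ₗ[F] 𝕍) hB = 1 :=
  LinearEquiv.ext fun y => by rw [cellB_apply, blockB_weylSp_mul_unipotentSp_apply]; rfl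

omit [ValuativeRel F] [TopologicalSpace F] [IsNonarchimedeanLocalField F] [DecidableEq ι] [MeasurableSpace F]
  [BorelSpace F] in
/-- canonical data of `w n(c)`: `γ = 0`. [cite: Weil1964, n° 7, Prop. 1, p. 152] -/
theorem cellGamma_weylSp_mul_unipotentSp (c : (ι → F) →ₗ[F] (ι → F))
    (hc : ∀ x x' : ι → F, dotProductBilin F F x (c x') = dotProductBilin F F x' (c x))
    (hB : Function.Bijective (blockB ((𝐰 * 𝐧 c hc : Spι) : 𝕍 ≃ₗ[F] 𝕍))) :
    cellGamma ((𝐰 * 𝐧 c hc : Spι) : 𝕍 ≃ₗ[F] 𝕍) hB = 0 :=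
  LinearMap.ext fun x => by
    simp only [cellGamma_apply, blockD_apply, Subgroup.coe_mul, LinearEquiv.mul_apply, coe_weylSp, weylσ_apply,
      coe_unipotentSp, unipotentσ_apply, LinearEquiv.neg_apply, neg_zero, LinearMap.zero_apply]

omit [ValuativeRel F] [TopologicalSpace F] [IsNonarchimedeanLocalField F] [DecidableEq ι] [MeasurableSpace F]
  [BorelSpace F] in
/-- canonical data of `w n(c)`: `δ = c`. [cite: Weil1964, n° 7, Prop. 1, p. 152] -/
theorem cellDelta_weylSp_mul_unipotentSp (c : (ι → F) →ₗ[F] (ι → F))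
    (hc : ∀ x x' : ι → F, dotProductBilin F F x (c x') = dotProductBilin F F x' (c x))
    (hB : Function.Bijective (blockB ((𝐰 * 𝐧 c hc : Spι) : 𝕍 ≃ₗ[F] 𝕍))) :
    cellDelta ((𝐰 * 𝐧 c hc : Spι) : 𝕍 ≃ₗ[F] 𝕍) hB = c :=
  LinearMap.ext fun x => by
    rw [cellDelta_apply, LinearEquiv.symm_apply_eq, cellB_apply, blockB_weylSp_mul_unipotentSp_apply]
    simp only [blockA_apply, Subgroup.coe_mul, LinearEquiv.mul_apply, coe_weylSp, weylσ_apply, coe_unipotentSp,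
      unipotentσ_apply, zero_add, LinearEquiv.refl_apply]

/-! ### §2.2 The big-cell operators of `w`, `m(a') w`, `w n(c)` -/

omit [DecidableEq ι] in
/-- `bigCellOp(w) = 𝓕`. [cite: Weil1964, n° 13 (29), p. 160; Rangarao1993, (3.9), p. 351] -/
theorem bigCellOp_weylSp (hψ : ψ.IsContinuousNontrivial) (hm : ψ.HasConductorExp m) :
    bigCellOp hl μ hψ hm (𝐰 : Spι) = fourierOpPi μ hψ hm
        := by
  have hB := blockB_weylSp_bijective (F := F) (ι := ι)
  rw [bigCellOp_of_bijective hl μ hψ hm _ hB, cellGamma_weylSp hB, cellB_weylSp hB, cellDelta_weylSp hB,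
    unipOpPi_zero, leviOpPi_one, one_mul, one_mul, mul_one]

/-- `bigCellOp(m(a') w) = leviOpPi a' ∘ 𝓕`. [cite: Weil1964, n° 13 (29), p. 160; Rangarao1993, (3.12), p. 352] -/
theorem bigCellOp_leviSp_mul_weylSp (hψ : ψ.IsContinuousNontrivial) (hm : ψ.HasConductorExp m)
    (a' : (ι → F) ≃ₗ[F] (ι → F)) :
    bigCellOp hl μ hψ hm (𝐦 a' * 𝐰 : Spι) = leviOpPi a' *
        fourierOpPi μ hψ hm := by
  have hB := blockB_leviSp_mul_weylSp_bijective (F := F) (ι := ι) a'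
  rw [bigCellOp_of_bijective hl μ hψ hm _ hB, cellGamma_leviSp_mul_weylSp a' hB, cellB_leviSp_mul_weylSp a' hB,
    cellDelta_leviSp_mul_weylSp a' hB, unipOpPi_zero, one_mul, mul_one]

omit [DecidableEq ι] in
/-- `bigCellOp(w n(c)) = 𝓕 ∘ unipOpPi c`. [cite: Weil1964, n° 13 (29), p. 160; Rangarao1993, (3.12), p. 352] -/
theorem bigCellOp_weylSp_mul_unipotentSp (hψ : ψ.IsContinuousNontrivial) (hm : ψ.HasConductorExp m)
    (c : (ι → F) →ₗ[F] (ι → F)) (hc : ∀ x x' : ι → F, dotProductBilin F F x (c x') = dotProductBilin F F x' (c x)) :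
    bigCellOp hl μ hψ hm (𝐰 * 𝐧 c hc : Spι) = fourierOpPi μ hψ hm * unipOpPi hl c := by
  have hB := blockB_weylSp_mul_unipotentSp_bijective (F := F) (ι := ι) c hc
  rw [bigCellOp_of_bijective hl μ hψ hm _ hB, cellGamma_weylSp_mul_unipotentSp c hc hB,
    cellB_weylSp_mul_unipotentSp c hc hB, cellDelta_weylSp_mul_unipotentSp c hc hB, unipOpPi_zero, leviOpPi_one,
    one_mul, one_mul]

/-! ### §2.3 The Leray cocycle is trivial against `P_{ℓ_Y}` -/

omit [DecidableEq ι] in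
/-- `c_{ℓ_Y}^{ψ(½·)}(p, g) = 1` for `p ℓ_Y = ℓ_Y`. [cite: Rangarao1993, Thm 4.1 (2), p. 358] -/
theorem lerayCocycleHalf_eq_one_of_map_eq_left (hψ : ψ.IsContinuousNontrivial) {p : Spι}
    (hp : Submodule.map ((p : 𝕍 ≃ₗ[F] 𝕍) : 𝕍 →ₗ[F] 𝕍) ℓY = ℓY) (g : Spι) : lerayCocycleHalf μ hψ p g = 1 := by
  refine Units.ext ?_
  rw [coe_lerayCocycleHalf_apply, Units.val_one]
  exact lerayCocycle_eq_one_of_map_eq_left μ (isContinuousNontrivial_mulShift_half hψ) 𝔸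
    (isotropic_of_orthogonal_eq_self orthogonal_prod_bot_top) hp _

omit [DecidableEq ι] in
/-- `c_{ℓ_Y}^{ψ(½·)}(g, p) = 1` for `p ℓ_Y = ℓ_Y`. [cite: Rangarao1993, Thm 4.1 (2), p. 358] -/
theorem lerayCocycleHalf_eq_one_of_map_eq_right (hψ : ψ.IsContinuousNontrivial) (g : Spι) {p : Spι}
    (hp : Submodule.map ((p : 𝕍 ≃ₗ[F] 𝕍) : 𝕍 →ₗ[F] 𝕍) ℓY = ℓY) : lerayCocycleHalf μ hψ g p = 1 := by
  refine Units.ext ?_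
  rw [coe_lerayCocycleHalf_apply, Units.val_one]
  exact lerayCocycle_eq_one_of_map_eq_right μ (isContinuousNontrivial_mulShift_half hψ) 𝔸
    (isotropic_of_orthogonal_eq_self orthogonal_prod_bot_top) g.2 hp

/-! ### §2.4 Values of the Schrödinger–Leray section -/

/-- **`r(p g) = r(p) r(g)` for `p ∈ P_{ℓ_Y}`** (Schrödinger–Leray section). [cite: Rangarao1993, Thm 3.5 (1), p. 355] -/
theorem schrodingerLeraySection_parabolic_mul (hψ : ψ.IsContinuousNontrivial) (hm : ψ.HasConductorExp m)
    (hμ : IsSelfDualMeasure ψ μ) {p : Spι} (hp : Submodule.map ((p : 𝕍 ≃ₗ[F] 𝕍) : 𝕍 →ₗ[F] 𝕍) ℓY = ℓY) (g : Spι) :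
    schrodingerLeraySection hl μ hψ hm hμ (p * g) =
      schrodingerLeraySection hl μ hψ hm hμ p * schrodingerLeraySection hl μ hψ hm hμ g := by
  have h := hasMultiplier_schrodingerLeraySection hl μ hψ hm hμ p g
  rw [lerayCocycleHalf_eq_one_of_map_eq_left μ hψ hp g, map_one, one_mul] at h
  exact h.symm

/-- **`r(g p) = r(g) r(p)` for `p ∈ P_{ℓ_Y}`** (Schrödinger–Leray section). [cite: Rangarao1993, Thm 3.5 (1), p. 355] -/
theorem schrodingerLeraySection_mul_parabolic (hψ : ψ.IsContinuousNontrivial) (hm : ψ.HasConductorExp m)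
    (hμ : IsSelfDualMeasure ψ μ) (g : Spι) {p : Spι} (hp : Submodule.map ((p : 𝕍 ≃ₗ[F] 𝕍) : 𝕍 →ₗ[F] 𝕍) ℓY = ℓY) :
    schrodingerLeraySection hl μ hψ hm hμ (g * p) =
      schrodingerLeraySection hl μ hψ hm hμ g * schrodingerLeraySection hl μ hψ hm hμ p := by
  have h := hasMultiplier_schrodingerLeraySection hl μ hψ hm hμ g p
  rw [lerayCocycleHalf_eq_one_of_map_eq_right μ hψ g hp, map_one, one_mul] at h
  exact h.symm

/-- **`r(w) = 𝓕`**: the Schrödinger–Leray section at the Weyl element IS the (self-dual) Fourier transform — no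
eighth root of unity ("`r(τ)`", [Rangarao1993] (3.9); Weil's `r(σ)` for `σ = w`, n° 13).
[cite: Rangarao1993, Lemma 3.2 (3.9), Thm 3.5, p. 351–356; Weil1964, n° 13 (29), p. 160] -/
theorem schrodingerLeraySection_weylSp (hψ : ψ.IsContinuousNontrivial) (hm : ψ.HasConductorExp m)
    (hμ : IsSelfDualMeasure ψ μ) : schrodingerLeraySection hl μ hψ hm hμ (𝐰 : Spι) = fourierOpPi μ hψ hm := by
  rw [schrodingerLeraySection_eq_of_bijective hl μ hψ hm hμ (blockB_weylSp_bijective (F := F) (ι := ι)),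
    bigCellOp_weylSp hl μ hψ hm]

/-- **`r(m(a)) = leviOpPi a`**: `(r(m(a)) Φ)(x) = |det a|^{1/2} Φ(a x)`-type Levi operator ("`r(m(a))`",
[Rangarao1993] (3.7)); computed as `r(w)⁻¹ c(w, m(a)) r(w m(a))` with `w m(a) = m(ᵗa⁻¹) w` in the big cell and
`c(w, m(a)) = 1`. [cite: Rangarao1993, Lemma 3.2 (3.7), Thm 3.5 (3), p. 351–356; Weil1964, n° 13, p. 160] -/
theorem schrodingerLeraySection_leviSp (hψ : ψ.IsContinuousNontrivial) (hm : ψ.HasConductorExp m)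
    (hμ : IsSelfDualMeasure ψ μ) (a : (ι → F) ≃ₗ[F] (ι → F)) :
    schrodingerLeraySection hl μ hψ hm hμ (𝐦 a : Spι) = leviOpPi a := by
  have hx := blockB_weylSp_bijective (F := F) (ι := ι)
  have hxg : Function.Bijective (blockB ((𝐰 * 𝐦 a : Spι) : 𝕍 ≃ₗ[F] 𝕍)) := by
    rw [weylSp_mul_leviSp]; exact blockB_leviSp_mul_weylSp_bijective (F := F) (ι := ι) (dualLeviPi a)
  rw [schrodingerLeraySection, HasMultiplierOn.lift_eq (isLeftGeneric_bigCellPi (F := F) (ι := ι))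
    scalarOpHom_mem_center (hasMultiplierOn_bigCellOp hl μ hψ hm hμ) hx hxg,
    lerayCocycleHalf_eq_one_of_map_eq_right μ hψ _ (map_leviSp_prod_bot_top a), map_one, one_mul,
    bigCellOp_weylSp hl μ hψ hm]
  rw [show bigCellOp hl μ hψ hm (𝐰 * 𝐦 a : Spι) = bigCellOp hl μ hψ hm (𝐦 (dualLeviPi a) * 𝐰 : Spι) by
    rw [weylSp_mul_leviSp], bigCellOp_leviSp_mul_weylSp hl μ hψ hm, ← fourierOpPi_mul_leviOpPi μ hψ hm a,
    inv_mul_cancel_left]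

/-- **`r(n(c)) = unipOpPi c`**: multiplication by `ψ(½⟨x, c x⟩)` ("`r(n(b))`", [Rangarao1993] (3.8)); computed as
`r(w)⁻¹ c(w, n(c)) r(w n(c))` with `w n(c)` in the big cell and `c(w, n(c)) = 1`.
[cite: Rangarao1993, Lemma 3.2 (3.8), Thm 3.5, p. 351–356; Weil1964, n° 13, p. 160] -/
theorem schrodingerLeraySection_unipotentSp (hψ : ψ.IsContinuousNontrivial) (hm : ψ.HasConductorExp m)
    (hμ : IsSelfDualMeasure ψ μ) (c : (ι → F) →ₗ[F] (ι → F))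
    (hc : ∀ x x' : ι → F, dotProductBilin F F x (c x') = dotProductBilin F F x' (c x)) :
    schrodingerLeraySection hl μ hψ hm hμ (𝐧 c hc : Spι) = unipOpPi hl c := by
  have hx := blockB_weylSp_bijective (F := F) (ι := ι)
  have hxg := blockB_weylSp_mul_unipotentSp_bijective (F := F) (ι := ι) c hc
  rw [schrodingerLeraySection, HasMultiplierOn.lift_eq (isLeftGeneric_bigCellPi (F := F) (ι := ι))
    scalarOpHom_mem_center (hasMultiplierOn_bigCellOp hl μ hψ hm hμ) hx hxg,
    lerayCocycleHalf_eq_one_of_map_eq_right μ hψ _ (map_unipotentSp_prod_bot_top c hc), map_one, one_mul,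
    bigCellOp_weylSp hl μ hψ hm, bigCellOp_weylSp_mul_unipotentSp hl μ hψ hm c hc, inv_mul_cancel_left]

/-- **`r(m(a) n(c)) = leviOpPi a ∘ unipOpPi c`** — the section on the whole Siegel parabolic `P = M N`
("`r(p)`, `p ∈ P`"). [cite: Rangarao1993, Lemma 3.2, Thm 3.5 (1), p. 351–356; MoeglinVignerasWaldspurger1987, Chap. 2 II.6] -/
theorem schrodingerLeraySection_leviSp_mul_unipotentSp (hψ : ψ.IsContinuousNontrivial) (hm : ψ.HasConductorExp m)
    (hμ : IsSelfDualMeasure ψ μ) (a : (ι → F) ≃ₗ[F] (ι → F)) (c : (ι → F) →ₗ[F] (ι → F))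
    (hc : ∀ x x' : ι → F, dotProductBilin F F x (c x') = dotProductBilin F F x' (c x)) :
    schrodingerLeraySection hl μ hψ hm hμ (𝐦 a * 𝐧 c hc : Spι) = leviOpPi a * unipOpPi hl c := by
  rw [schrodingerLeraySection_parabolic_mul hl μ hψ hm hμ (map_leviSp_prod_bot_top a),
    schrodingerLeraySection_leviSp hl μ hψ hm hμ, schrodingerLeraySection_unipotentSp hl μ hψ hm hμ]

/-- **`r(p₁ w p₂) = r(p₁) 𝓕 r(p₂)`** for `p₁, p₂ ∈ P_{ℓ_Y}` — the section on the big cell `P w P` in Rao's form.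
[cite: Rangarao1993, Thm 3.5 (1), p. 355; Weil1964, n° 13 (29), p. 160] -/
theorem schrodingerLeraySection_parabolic_weylSp_parabolic (hψ : ψ.IsContinuousNontrivial)
    (hm : ψ.HasConductorExp m) (hμ : IsSelfDualMeasure ψ μ) {p₁ p₂ : Spι}
    (hp₁ : Submodule.map ((p₁ : 𝕍 ≃ₗ[F] 𝕍) : 𝕍 →ₗ[F] 𝕍) ℓY = ℓY)
    (hp₂ : Submodule.map ((p₂ : 𝕍 ≃ₗ[F] 𝕍) : 𝕍 →ₗ[F] 𝕍) ℓY = ℓY) :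
    schrodingerLeraySection hl μ hψ hm hμ (p₁ * 𝐰 * p₂) =
      schrodingerLeraySection hl μ hψ hm hμ p₁ * fourierOpPi μ hψ hm * schrodingerLeraySection hl μ hψ hm hμ p₂ := by
  rw [schrodingerLeraySection_mul_parabolic hl μ hψ hm hμ _ hp₂,
    schrodingerLeraySection_parabolic_mul hl μ hψ hm hμ hp₁, schrodingerLeraySection_weylSp hl μ hψ hm hμ]

/-- **`r(w) r(w) = r(m(-1))`** (`= Φ ↦ Φ(-·)`): consistent with `c(w, w) = 1` and `w² = m(-1)`.
[cite: Rangarao1993, Thm 3.5 (proof), p. 356; Weil1964, n° 13, p. 160] -/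
theorem schrodingerLeraySection_weylSp_mul_self (hψ : ψ.IsContinuousNontrivial) (hm : ψ.HasConductorExp m)
    (hμ : IsSelfDualMeasure ψ μ) :
    schrodingerLeraySection hl μ hψ hm hμ (𝐰 : Spι) *
        schrodingerLeraySection hl μ hψ hm hμ (𝐰 : Spι) =
      schrodingerLeraySection hl μ hψ hm hμ (𝐦 (LinearEquiv.neg F) : Spι) := by
  rw [schrodingerLeraySection_weylSp hl μ hψ hm hμ, schrodingerLeraySection_leviSp hl μ hψ hm hμ,
    fourierOpPi_mul_fourierOpPi μ hψ hm hμ]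

/-- the same values for the IMPLEMENTER section `schrodingerLerayImplementerSection` (whose cocycle is
`lerayCentralCocycle μ ψ(½·) A ℓ_Y`, `schrodingerCocyclePi_eq_lerayCentralCocycle`): at `w`.
[cite: Rangarao1993, Lemma 3.2 (3.9), p. 351] -/
theorem schrodingerLerayImplementerSection_weylSp (hψ : ψ.IsContinuousNontrivial) (hm : ψ.HasConductorExp m)
    (hμ : IsSelfDualMeasure ψ μ) :
    schrodingerLerayImplementerSection hl hb μ hψ hm hμ (𝐰 : Spι) = fourierOpPi μ hψ hm := by
  rw [schrodingerLerayImplementerSection_apply, schrodingerLeraySection_weylSp]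

/-- … on the Levi. [cite: Rangarao1993, Lemma 3.2 (3.7), p. 351] -/
theorem schrodingerLerayImplementerSection_leviSp (hψ : ψ.IsContinuousNontrivial) (hm : ψ.HasConductorExp m)
    (hμ : IsSelfDualMeasure ψ μ) (a : (ι → F) ≃ₗ[F] (ι → F)) :
    schrodingerLerayImplementerSection hl hb μ hψ hm hμ (𝐦 a : Spι) = leviOpPi
        a := by
  rw [schrodingerLerayImplementerSection_apply, schrodingerLeraySection_leviSp]

/-- … on the unipotent radical. [cite: Rangarao1993, Lemma 3.2 (3.8), p. 351] -/
theorem schrodingerLerayImplementerSection_unipotentSp (hψ : ψ.IsContinuousNontrivial)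
    (hm : ψ.HasConductorExp m) (hμ : IsSelfDualMeasure ψ μ) (c : (ι → F) →ₗ[F] (ι → F))
    (hc : ∀ x x' : ι → F, dotProductBilin F F x (c x') = dotProductBilin F F x' (c x)) :
    schrodingerLerayImplementerSection hl hb μ hψ hm hμ (𝐧 c hc : Spι) = unipOpPi hl c := by
  rw [schrodingerLerayImplementerSection_apply, schrodingerLeraySection_unipotentSp]

end Pi

end Literature.RepresentationTheory.HeisenbergGroup
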